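/-
Copyright (c) 2026. All rights reserved.
Released under Apache 2.0 license as described in the file LICENSE.
Authors: HodgeCM publication cell (pub-hodgecm), GR lane, seat GR-2 (`pub-hodgecm-own-hyp34`).
-/
import Literature.NumberTheory.GelbartRogawski1991.Prop311PrintedTransport
import HarnessLib

-- build-lane note (ops-buildfix G11b-3 recipe): dependent telescopes of the dual-pair datum; elaborate sequentially.
set_option Elab.async false

/-!
# [GelbartRogawski1991, Prop. 3.1.1]: transport to the printed objects ALONG THE SECTION — continuity is needed only
# for the composite `φ ∘ s`, not for the `Mp` leg `φ` itself

Topic `NumberTheory/GelbartRogawski1991`; namespace `Literature.NumberTheory.GelbartRogawski1991.Prop311`.  Proved lemmas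
only; nothing of [GelbartRogawski1991] is asserted; `Prop311AsPrinted` is untouched.

`Prop311PrintedTransport.compatibleSplitting_printedDatum_of_frame` / `printed_conclusion_of_frame` move a compatible
splitting on the tree's matrix carriers to the PRINTED datum along a homomorphism `φ : Mp → Mp_𝐀(W)` over
`(frameSp b)⁻¹` that is CONTINUOUS on all of `Mp`.  For the smooth model `Mp = Weil1964.adelicMpCont` (coefficient
topology: pointwise convergence of `ω(p)Φ`) and the printed `Mp_𝐀(W)` (strong operator topology on the Hilbert space
of `ρ_ψ`, rendering R2) the continuity of the leg `φ` on the whole group is the strong continuity of the adelic Weil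
representation [Weil1964, Chap. III n° 39–43], whereas what print's clause (2) — "*There exists a continuous section
`s : G(𝐀) → Mp_𝐀(W)`*" (p. 455 L1–2) — needs is the continuity of the COMPOSITE `φ ∘ s` along the section of record
(where locally uniform Schwartz–Bruhat majorants are available, [Weil1964, Chap. III n° 41 Lemme 5]).  This file gives
the correspondingly weaker-hypothesis variants:

* **`compatibleSplitting_printedDatum_of_frame_along`**: same data as `compatibleSplitting_printedDatum_of_frame`, but
  instead of `Continuous φ` and `D.CompatibleSplitting` one supplies a compatible splitting `s` of `D` (`D.IsCompatible s`)
  with `g ↦ φ (s g)` continuous; conclusion `(printedDatum F E V Φ ρ i hi).CompatibleSplitting`;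
* **`printed_conclusion_of_frame_along`**: the two printed clauses verbatim from the same input.
The old statements follow from the new ones (take any continuous compatible `s`).

## References
* [GelbartRogawski1991] S. Gelbart, J. Rogawski, Invent. Math. 105 (1991) 445–472, §3.1 p. 454 L17–42, Prop. 3.1.1
  p. 455 L1–2.
* [Weil1964] A. Weil, Acta Math. 111 (1964) 143–211, Chap. III n° 39–43.
-/

set_option autoImplicit false

noncomputable section

open NumberField
open scoped TensorProduct Matrix
open Literature.NumberTheory.Automorphic
open Literature.NumberTheory.Automorphic.UnitaryGroup
open Literature.RepresentationTheory.HeisenbergGroup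

namespace Literature.NumberTheory.GelbartRogawski1991

namespace Prop311

open QuadraticCoordinates

variable (F : Type) [Field F] [NumberField F]
variable (E : Type) [Field E] [NumberField E] [Algebra F E] [Algebra.IsQuadraticExtension F E]
variable (σ : E ≃ₐ[F] E) {δ : E} (hσδ : σ δ = -δ) (hδ : δ ≠ 0) {d : F} (hd : δ * δ = algebraMap F E d)
variable (V : Type) [AddCommGroup V] [Module F V] [Module E V] [IsScalarTower F E V]
variable {n : ℕ} (b : Module.Basis (Fin n) E V)
variable (Φ : V →ₗ[F] V →ₗ[F] E) (f : Fin n → F)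

section TransportAlong

variable {S : Type} [NormedAddCommGroup S] [InnerProductSpace ℂ S]
variable (ρ : Representation ℂ (AdelicHeisenberg F E V Φ) S)
variable (i : ratSp F E V Φ →* adelicMp F E V Φ ρ) (hi : IsRationalSplitting F E V Φ ρ i)

/-- **TRANSPORT TO THE PRINTED DATUM ALONG THE SECTION.**  As `compatibleSplitting_printedDatum_of_frame` (a
`Φ`-orthogonal frame `b`, `T = diag(-2 d fᵢ)`, a splitting datum `D` of the tree's shape on the matrix carriers, the
rational splitting `i` unique, a homomorphism `φ : Mp → Mp_𝐀(W)` over `(frameSp b)⁻¹`), EXCEPT that no topology on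
`Mp` and no continuity of `φ` is asked: instead a compatible splitting `s` of `D` with `g ↦ φ (s g)` continuous.
Then `printedDatum F E V Φ ρ i hi` has a compatible (continuous) splitting, namely `φ ∘ s ∘ frameUnitary'`.
[cite: GelbartRogawski1991, §3.1 p. 454 L17–42; Prop. 3.1.1 p. 455 L1–2] -/
theorem compatibleSplitting_printedDatum_of_frame_along
    (hΦ₁ : ∀ (e : E) (x y : V), Φ (e • x) y = e * Φ x y) (hΦ₂ : ∀ (e : E) (x y : V), Φ x (e • y) = Φ x y * σ e)
    (hb : ∀ i j, i ≠ j → Φ (b i) (b j) = 0) (hf : ∀ i, Φ (b i) (b i) = algebraMap F E (f i) * δ) (hf0 : ∀ i, f i ≠ 0)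
    (hi! : ∀ i' : ratSp F E V Φ →* adelicMp F E V Φ ρ, IsRationalSplitting F E V Φ ρ i' → i' = i)
    {J' : Matrix (Fin n) (Fin n) E} (hJ' : J' = (symplecticGram F d f).map (algebraMap F E))
    {T' : Matrix (Fin n) (Fin n) (AdeleRing (𝓞 F) F)}
    (hT'eq : T' = (symplecticGram F d f).map (algebraMap F (AdeleRing (𝓞 F) F))) (hT' : IsUnit T'.det)
    {Mp : Type*} [Group Mp]
    (D : SplittingDatum (symplecticGroup (polar (Weil1964.adelicForm F (Fin n) T'))) Mp (UnitaryGroup.adelic F E σ n J'))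
    (hDtoSp : ∀ g : UnitaryGroup.adelic F E σ n J',
      ((D.toSp g : symplecticGroup (polar (Weil1964.adelicForm F (Fin n) T'))) :
          ((Fin n → AdeleRing (𝓞 F) F) × (Fin n → AdeleRing (𝓞 F) F)) ≃ₗ[AdeleRing (𝓞 F) F]
            ((Fin n → AdeleRing (𝓞 F) F) × (Fin n → AdeleRing (𝓞 F) F))) =
        (adelicToSymplectic F E σ n hσδ hδ hd (isSymm_symplecticGram F d f) hJ' g).1)
    (hDrat : D.ratPts = (UnitaryGroup.toAdelic F E σ n J').range)
    (hDsp : D.spRat = (Weil1964.ratSp F T' hT').range)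
    (φ : Mp →* adelicMp F E V Φ ρ)
    (hproj : ∀ m : Mp,
      frameConj F E σ hσδ hδ hd V b ((proj F E V Φ ρ (φ m) : adelicSp F E V Φ) :
          AdelicSpace F V ≃ₗ[AdeleRing (𝓞 F) F] AdelicSpace F V) =
        ((D.proj m : symplecticGroup (polar (Weil1964.adelicForm F (Fin n) T'))) :
          ((Fin n → AdeleRing (𝓞 F) F) × (Fin n → AdeleRing (𝓞 F) F)) ≃ₗ[AdeleRing (𝓞 F) F]
            ((Fin n → AdeleRing (𝓞 F) F) × (Fin n → AdeleRing (𝓞 F) F))))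
    (h : ∃ s : UnitaryGroup.adelic F E σ n J' →* Mp, D.IsCompatible s ∧ Continuous fun g => φ (s g)) :
    (printedDatum F E V Φ ρ i hi).CompatibleSplitting := by
  subst hJ' hT'eq
  have hT : IsUnit (symplecticGram F d f).det := isUnit_det_symplecticGram F f (d_ne_zero F E hδ hd) hf0
  have hJ : IsUnit (gramMatrix F E V b Φ).det := isUnit_det_gramMatrix_of_orthogonal F E hδ V b Φ f hb hf hf0
  -- the isomorphism of the two `Sp_F(W)`, over `(frameSp b)⁻¹`
  let e₀ : D.spRat ≃* (printedDatum F E V Φ ρ i hi).spRat :=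
    (MulEquiv.subgroupCongr hDsp).trans (frameSpRat F E σ hσδ hδ hd V b Φ f hΦ₁ hΦ₂ hb hf hT).symm
  have he₀ : ∀ x : D.spRat, ((e₀ x : (printedDatum F E V Φ ρ i hi).spRat) : adelicSp F E V Φ) =
      (frameSp F E σ hσδ hδ hd V b Φ f hΦ₁ hΦ₂ hb hf).symm.toMonoidHom (x : symplecticGroup (polar (framePairing F d f))) :=
    fun x => by
      rw [MulEquiv.coe_toMonoidHom]
      exact coe_frameSpRat_symm F E σ hσδ hδ hd V b Φ f hΦ₁ hΦ₂ hb hf hT _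
  obtain ⟨s, hs, hφs⟩ := h
  refine ⟨(φ.comp s).comp (frameUnitary' F E σ hσδ hδ hd V b Φ f hΦ₁ hΦ₂ hb hf).toMonoidHom,
    hφs.comp (continuous_frameUnitary' F E σ hσδ hδ hd V b Φ f hΦ₁ hΦ₂ hb hf hJ), ?_⟩
  refine SplittingDatum.IsCompatible.transport_of_unique
    (frameSp F E σ hσδ hδ hd V b Φ f hΦ₁ hΦ₂ hb hf).symm.toMonoidHom φ
    (frameUnitary' F E σ hσδ hδ hd V b Φ f hΦ₁ hΦ₂ hb hf).toMonoidHom ?_ ?_ ?_ e₀ he₀ ?_ hs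
  · -- `π' ∘ φ = eSp ∘ π`
    intro m
    rw [printedDatum_proj, MulEquiv.coe_toMonoidHom, MulEquiv.eq_symm_apply]
    exact Subtype.ext (hproj m)
  · -- `ι' = eSp ∘ ι ∘ eG`
    intro g
    rw [printedDatum_toSp, MulEquiv.coe_toMonoidHom, MulEquiv.coe_toMonoidHom, MulEquiv.eq_symm_apply,
      ← adelicToSymplectic_frameUnitary']
    exact (Subtype.ext (hDtoSp _)).symm
  · -- `eG (G'(F)) ⊆ G(F)`
    intro γ hγ
    rw [hDrat, MulEquiv.coe_toMonoidHom, frameUnitary'_mem_range_toAdelic_iff]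
    rw [printedDatum_ratPts] at hγ
    exact (mem_range_ratUnitaryToAdelic_iff F E V Φ γ).1 hγ
  · -- `i'` is THE rational splitting
    exact printedDatum_ratSplit_unique F E V Φ ρ i hi hi!

include hi in
/-- **THE PRINTED CONCLUSION FROM THE FRAME, ALONG THE SECTION**: under the hypotheses of
`compatibleSplitting_printedDatum_of_frame_along` (no continuity of the leg `φ`, only of `φ ∘ s` for a compatible `s`),
the two clauses of [GelbartRogawski1991, Prop. 3.1.1] hold for the printed objects verbatim: (1) "*The covering `π`
splits over `G(𝐀)`*" and (2) "*There exists a continuous section `s : G(𝐀) → Mp_𝐀(W)` such that `s(G(F))` is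
contained in `i(Sp_F(W))`*". [cite: GelbartRogawski1991, Prop. 3.1.1 p. 455 L1–2] -/
theorem printed_conclusion_of_frame_along
    (hΦ₁ : ∀ (e : E) (x y : V), Φ (e • x) y = e * Φ x y) (hΦ₂ : ∀ (e : E) (x y : V), Φ x (e • y) = Φ x y * σ e)
    (hb : ∀ i j, i ≠ j → Φ (b i) (b j) = 0) (hf : ∀ i, Φ (b i) (b i) = algebraMap F E (f i) * δ) (hf0 : ∀ i, f i ≠ 0)
    (hi! : ∀ i' : ratSp F E V Φ →* adelicMp F E V Φ ρ, IsRationalSplitting F E V Φ ρ i' → i' = i)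
    {J' : Matrix (Fin n) (Fin n) E} (hJ' : J' = (symplecticGram F d f).map (algebraMap F E))
    {T' : Matrix (Fin n) (Fin n) (AdeleRing (𝓞 F) F)}
    (hT'eq : T' = (symplecticGram F d f).map (algebraMap F (AdeleRing (𝓞 F) F))) (hT' : IsUnit T'.det)
    {Mp : Type*} [Group Mp]
    (D : SplittingDatum (symplecticGroup (polar (Weil1964.adelicForm F (Fin n) T'))) Mp (UnitaryGroup.adelic F E σ n J'))
    (hDtoSp : ∀ g : UnitaryGroup.adelic F E σ n J',
      ((D.toSp g : symplecticGroup (polar (Weil1964.adelicForm F (Fin n) T'))) :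
          ((Fin n → AdeleRing (𝓞 F) F) × (Fin n → AdeleRing (𝓞 F) F)) ≃ₗ[AdeleRing (𝓞 F) F]
            ((Fin n → AdeleRing (𝓞 F) F) × (Fin n → AdeleRing (𝓞 F) F))) =
        (adelicToSymplectic F E σ n hσδ hδ hd (isSymm_symplecticGram F d f) hJ' g).1)
    (hDrat : D.ratPts = (UnitaryGroup.toAdelic F E σ n J').range)
    (hDsp : D.spRat = (Weil1964.ratSp F T' hT').range)
    (φ : Mp →* adelicMp F E V Φ ρ)
    (hproj : ∀ m : Mp,
      frameConj F E σ hσδ hδ hd V b ((proj F E V Φ ρ (φ m) : adelicSp F E V Φ) :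
          AdelicSpace F V ≃ₗ[AdeleRing (𝓞 F) F] AdelicSpace F V) =
        ((D.proj m : symplecticGroup (polar (Weil1964.adelicForm F (Fin n) T'))) :
          ((Fin n → AdeleRing (𝓞 F) F) × (Fin n → AdeleRing (𝓞 F) F)) ≃ₗ[AdeleRing (𝓞 F) F]
            ((Fin n → AdeleRing (𝓞 F) F) × (Fin n → AdeleRing (𝓞 F) F))))
    (h : ∃ s : UnitaryGroup.adelic F E σ n J' →* Mp, D.IsCompatible s ∧ Continuous fun g => φ (s g)) :
    (∃ s : adelicUnitary F E V Φ →* adelicMp F E V Φ ρ,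
        ∀ g : adelicUnitary F E V Φ,
          projEnd F E V Φ ρ (s g) =
            ((g : AdelicSpace F V ≃ₗ[AdeleRing (𝓞 F) F] AdelicSpace F V) :
              AdelicSpace F V →ₗ[AdeleRing (𝓞 F) F] AdelicSpace F V)) ∧
      ∃ s : adelicUnitary F E V Φ →* adelicMp F E V Φ ρ,
        Continuous s ∧
        (∀ g : adelicUnitary F E V Φ,
          projEnd F E V Φ ρ (s g) =
            ((g : AdelicSpace F V ≃ₗ[AdeleRing (𝓞 F) F] AdelicSpace F V) :
              AdelicSpace F V →ₗ[AdeleRing (𝓞 F) F] AdelicSpace F V)) ∧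
        ∀ g : adelicUnitary F E V Φ,
          IsRationalPoint F E V Φ (g : AdelicSpace F V ≃ₗ[AdeleRing (𝓞 F) F] AdelicSpace F V) → s g ∈ i.range := by
  obtain ⟨s, hsc, hs₁, hs₂⟩ := (compatibleSplitting_printedDatum_iff F E V Φ ρ i hi).1
    (compatibleSplitting_printedDatum_of_frame_along F E σ hσδ hδ hd V b Φ f ρ i hi hΦ₁ hΦ₂ hb hf hf0 hi! hJ' hT'eq hT' D
      hDtoSp hDrat hDsp φ hproj h)
  exact ⟨⟨s, hs₁⟩, s, hsc, hs₁, hs₂⟩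

end TransportAlong

end Prop311

end Literature.NumberTheory.GelbartRogawski1991

end
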